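import Summits.KontsevichZagierPeriods.KontsevichZagierPeriods.Theorems.ReductionTwoSix.Negative.Kit

/-!
# `ReductionTwoSix` (stmt-KontsevichZagierPeriods-3871) — negative side IV: non-vacuity and the
falsity channel

Refuter (`cdisprove`) results, kernel-checked: the hypothesis class of the crux is inhabited for EVERY
`P ∈ ℚ[t]` (`sectorRep`, `sector_nonvacuous`: `|P(t)|/(1−t⁶) ≤ (Σ|coeff|)/(1−t)` on `(0,1)`, so
integrability of `1/(1−xy)` on the box suffices); the crux holds by `refl` on normal forms
(`reductionTwoSix_on_normalForms`); and `falsity_channel`: under `RigidityInput` the crux forces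
every sector value into `ℚ + ℚI₁ + ℚI₂` — the only way to refute it by soundness is a `P` whose box
integral provably escapes, and by the level-6 Hurwitz closed forms (`h₅ = π²/216, h₂ = π²/72,
h₁ = π²/54 + L/8, h₃ = π²/54 − L/8, h₀ = π²/18 + 5L/8, h₄ = π²/18 − 5L/8`) none does.
[Kontsevich–Zagier 2001 §1.1–1.2; Calegari–Dimitrov–Tang 2024 Cor. 2]
-/

namespace Summit.KontsevichZagierPeriods.HurwitzMicroSectors.ReductionTwoSixNegative

open MeasureTheory Set
open Literature.NumberTheory.Transcendental
open Summit.KontsevichZagierPeriods.KontsevichZagierPeriods.Theses.HurwitzMicroSectors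

noncomputable section

variable {I₁ I₂ : ℝ}

/-! ## §6 Non-vacuity for every `P`, the crux on normal forms, the falsity channel made explicit -/

/-- The crux HOLDS by `refl` on members whose integrand already is a normal form on the box
(a 3-dimensional subfamily: `P = a(1−t⁶) + b(1+t+…+t⁵) + c(1−t+t³−t⁴)`). -/
theorem reductionTwoSix_on_normalForms (r : KZ.IntegralRep 2) {a b c : ℚ}
    (hdom : r.domain = box) (hint : EqOn r.integrand (nf a b c) box) :
    ∃ (a b c : ℚ) (r' : KZ.IntegralRep 2), r'.domain = {x | ∀ i, x i ∈ Set.Ioo (0:ℝ) 1} ∧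
      Set.EqOn r'.integrand
        (fun x => (a : ℝ) + b / (1 - x 0 * x 1) + c / (1 + x 0 * x 1 + (x 0 * x 1) ^ 2)) r'.domain ∧
      KZ.Equivalent r r' :=
  ⟨a, b, c, r, hdom, fun x hx => hint (show x ∈ box from hdom ▸ hx), KZ.Equivalent.refl r⟩

open Polynomial in
/-- Uniform bound for `|P(t)|` on `[0,1]`: the sum of the absolute values of the coefficients. -/
def coeffBound (P : ℚ[X]) : ℝ := ∑ i ∈ Finset.range (P.natDegree + 1), |(P.coeff i : ℝ)|

open Polynomial in
/-- Auxiliary: `coeffBound_nonneg`. [folklore] -/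
theorem coeffBound_nonneg (P : ℚ[X]) : 0 ≤ coeffBound P :=
  Finset.sum_nonneg fun _ _ => abs_nonneg _

open Polynomial in
/-- Auxiliary: `abs_aeval_le`. [folklore] -/
theorem abs_aeval_le (P : ℚ[X]) {t : ℝ} (h0 : 0 ≤ t) (h1 : t ≤ 1) :
    |Polynomial.aeval t P| ≤ coeffBound P := by
  rw [Polynomial.aeval_eq_sum_range, coeffBound]
  refine (Finset.abs_sum_le_sum_abs _ _).trans (Finset.sum_le_sum fun i _ => ?_)
  rw [Algebra.smul_def, abs_mul, eq_ratCast]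
  calc |(P.coeff i : ℝ)| * |t ^ i| ≤ |(P.coeff i : ℝ)| * 1 := by
        gcongr
        rw [abs_of_nonneg (pow_nonneg h0 _)]
        exact pow_le_one₀ h0 h1
    _ = _ := mul_one _

open Polynomial in
/-- The sector integrand `P(xy)/(1−(xy)⁶)`, literally as in the crux. -/
def sectorFun (P : ℚ[X]) : (Fin 2 → ℝ) → ℝ :=
  fun x => Polynomial.aeval (x 0 * x 1) P / (1 - (x 0 * x 1) ^ 6)

open Polynomial in
/-- Auxiliary: `continuousOn_sectorFun`. [folklore] -/
theorem continuousOn_sectorFun (P : ℚ[X]) : ContinuousOn (sectorFun P) box := by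
  have ht : Continuous fun x : Fin 2 → ℝ => x 0 * x 1 := (continuous_apply 0).mul (continuous_apply 1)
  refine ContinuousOn.div ?_ ?_ (fun x hx => one_sub_t6_ne hx)
  · exact ((Polynomial.continuous_aeval P).comp ht).continuousOn
  · exact (continuous_const.sub (ht.pow 6)).continuousOn

open Polynomial in
/-- Every member of the sector is absolutely integrable on the box, given only the integrability of
`1/(1−xy)` there (`|P(t)|/(1−t⁶) ≤ (Σ|coeff|)/(1−t)` on `(0,1)`). -/
theorem integrableOn_sectorFun
    (hint : IntegrableOn (fun x : Fin 2 → ℝ => 1 / (1 - x 0 * x 1)) box) (P : ℚ[X]) :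
    IntegrableOn (sectorFun P) box := by
  refine Integrable.mono' (hint.const_mul (coeffBound P))
    ((continuousOn_sectorFun P).aestronglyMeasurable measurableSet_box) ?_
  refine ae_restrict_of_forall_mem measurableSet_box fun x hx => ?_
  have h0 := t_pos hx
  have h1 := t_lt_one hx
  simp only [sectorFun, norm_div, Real.norm_eq_abs]
  generalize x 0 * x 1 = t at h0 h1 ⊢
  have h6 : 0 < 1 - t ^ 6 := sub_pos.mpr (pow_lt_one₀ h0.le h1 (by norm_num))
  have hle : 1 - t ≤ 1 - t ^ 6 := by
    have : t ^ 6 ≤ t := pow_le_of_le_one h0.le h1.le (by norm_num)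
    linarith
  rw [abs_of_pos h6]
  calc |Polynomial.aeval t P| / (1 - t ^ 6) ≤ coeffBound P / (1 - t ^ 6) := by
        gcongr; exact abs_aeval_le P h0.le h1.le
    _ ≤ coeffBound P / (1 - t) :=
        div_le_div_of_nonneg_left (coeffBound_nonneg P) (sub_pos.mpr h1) hle
    _ = coeffBound P * (1 / (1 - t)) := by ring

open Polynomial in
/-- Numerator of the sector integrand as a `ℚ`-polynomial in two variables. -/
def sectorNum (P : ℚ[X]) : MvPolynomial (Fin 2) ℚ :=
  Polynomial.aeval (MvPolynomial.X 0 * MvPolynomial.X 1 : MvPolynomial (Fin 2) ℚ) P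

/-- Denominator `1 − (X₀X₁)⁶`. -/
def sectorDen : MvPolynomial (Fin 2) ℚ := 1 - (MvPolynomial.X 0 * MvPolynomial.X 1) ^ 6

open Polynomial in
/-- Auxiliary: `aeval_sectorNum`. [folklore] -/
theorem aeval_sectorNum (P : ℚ[X]) (x : Fin 2 → ℝ) :
    MvPolynomial.aeval x (sectorNum P) = Polynomial.aeval (x 0 * x 1) P := by
  simp only [sectorNum]
  rw [← Polynomial.aeval_algHom_apply]
  simp

/-- Auxiliary: `aeval_sectorDen`. [folklore] -/
theorem aeval_sectorDen (x : Fin 2 → ℝ) : MvPolynomial.aeval x sectorDen = 1 - (x 0 * x 1) ^ 6 := by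
  simp [sectorDen]

open Polynomial in
/-- The sector member `∫_(0,1)² P(xy)/(1−(xy)⁶)` as a `KZ.IntegralRep 2` — the hypothesis class of
the crux is INHABITED for every `P` (given `IntegrableOn (1/(1−xy)) box`, item BoxIntegralZetaTwo). -/
def sectorRep (hint : IntegrableOn (fun x : Fin 2 → ℝ => 1 / (1 - x 0 * x 1)) box) (P : ℚ[X]) :
    KZ.IntegralRep 2 where
  domain := box
  integrand := sectorFun P
  isSemialgebraic_domain := isSemialgebraic_box
  isSemialgebraicFunOn_integrand :=
    (isSemialgebraicFunOn_aeval_div_aeval isSemialgebraic_box (sectorNum P) sectorDen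
      (fun x hx => by rw [aeval_sectorDen]; exact one_sub_t6_ne hx)).congr
      (fun x _ => by simp only [aeval_sectorNum, aeval_sectorDen, sectorFun])
  integrableOn := integrableOn_sectorFun hint P

open Polynomial in
/-- NON-VACUITY: for every `P` some representation satisfies the crux's hypotheses. -/
theorem sector_nonvacuous (hint : IntegrableOn (fun x : Fin 2 → ℝ => 1 / (1 - x 0 * x 1)) box)
    (P : ℚ[X]) : ∃ r : KZ.IntegralRep 2, r.domain = {x | ∀ i, x i ∈ Set.Ioo (0:ℝ) 1} ∧
      Set.EqOn r.integrand (fun x => Polynomial.aeval (x 0 * x 1) P / (1 - (x 0 * x 1) ^ 6)) r.domain :=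
  ⟨sectorRep hint P, rfl, fun _ _ => rfl⟩

open Polynomial in
/-- THE FALSITY CHANNEL, made explicit: under the rigidity inputs the crux forces every sector value
into `ℚ + ℚ·I₁ + ℚ·I₂`; a refutation by soundness = a `P` whose box integral is provably outside.
By the Hurwitz bookkeeping (docblock; job j007874) no such `P` exists. -/
theorem falsity_channel (h : RigidityInput I₁ I₂) (H : ReductionTwoSix) (P : ℚ[X]) :
    ∃ a b c : ℚ, (sectorRep h.int₁ P).value = a + b * I₁ + c * I₂ := by
  obtain ⟨a, b, c, r', hdom', hint', heqv⟩ := H (sectorRep h.int₁ P) P rfl (fun _ _ => rfl)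
  refine ⟨a, b, c, ?_⟩
  rw [KZ.Equivalent.value_eq_holds heqv]
  exact value_of_nf h r' hdom' (fun x hx => hint' (show x ∈ r'.domain from hdom'.symm ▸ hx))


end

end Summit.KontsevichZagierPeriods.HurwitzMicroSectors.ReductionTwoSixNegative
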